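import Mathlib
import HarnessLib
import Summits.HubbardSuperconductivity.HubbardSuperconductivity.Theorems.KLProgrammeCooperChannelRiccatiFlowCascade
import Summits.HubbardSuperconductivity.HubbardSuperconductivity.Theorems.KLProgrammeCooperChannelRiccatiFlowEnvelope

/-!
# Route `KLProgramme` — DECOMP C2 «ChannelRiccati» in Lean, IV: the assembled block flow
# (the statement Lemma E.4 cites)

Cell gate-hubbard-kl, seat p3; continuation of files I–III (`KLProgrammeCooperChannelRiccatiFlow.lean`,
`…Cascade.lean`, `…Envelope.lean`; same namespace).  Files I–II reduce ONE renormalisation step of a `D₄` block of the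
Cooper vertex to the scalar cascade map of the two ends of its quadratic form, file III is the scalar bookkeeping of the
iteration.  This file assembles them into the operator-level statement DECOMP App. E, Lemma E.4 consumes:

* `norm_eq_max_abs_formInf_formSup` — for a SYMMETRIC bounded operator `‖T‖ = max (|formInf T|, |formSup T|)` (the norm
  is the numerical radius; Mathlib's `ContinuousLinearMap.norm_eq_iSup_rayleighQuotient`), so two-sided envelopes of the
  form ARE a norm bound (`norm_le_of_forms_le`) — this is what closes the smallness hypothesis `b_k ‖V_k‖ ≤ 1/4` of the
  one-step theorems inside the induction;
* `abs_formInf_sub_cascadeStep_le` / `abs_formSup_sub_cascadeStep_le` — one step of a block flow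
  `V_{k+1} = V_k R_k + P_k` (`R_k = (1 + b_k V_k)⁻¹`, `‖P_k‖ ≤ e_k`): both ends of the form follow `cascadeStep b_k` up to
  `e_k`; `norm_inverse_le` bounds a two-sided inverse of `1 + X`, `‖X‖ < 1` (only the inverse EQUATIONS are ever assumed,
  no completeness);
* `blockFlow_envelopes` — **the assembled theorem**: for symmetric blocks `V_k`, bubble masses `b_k ≥ 0`, remainder sizes
  `e_k ≥ 0`, a norm budget `M` with `b_k M ≤ 1/4`, initial data `-A₀ ≤ formInf V₀`, `formSup V₀ ≤ A` and NO ONSET up to `N`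
  (`(A₀ + Σ_{j<N} e_j)(Σ_{j<N} b_j) < 1`, with the resulting envelopes inside the budget), the flow satisfies for all
  `k ≤ N` (with `E_k = Σ_{j<k} e_j`, `B_k = Σ_{j<k} b_j`):
  `-(A₀ + E_k)/(1 - (A₀ + E_k) B_k) ≤ formInf V_k ≤ formInf V₀ + E_k`, `formSup V_k ≤ A/(1 + A B_k) + E_k`, `‖V_k‖ ≤ M` —
  where the step hypotheses (existence of `R_k`, the remainder bound) may ASSUME `‖V_k‖ ≤ M` (joint induction: the
  smallness is derived, never postulated).  These are Lemma E.4's block envelopes «repulsive blocks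
  `0 ≤ V ≤ V₀(1 + b V₀ |j|)⁻¹ + C U²`, attractive ones `-a U²(1+η')(1 - a U²(1+η')|j|)⁻¹ - C U² ≤ V ≤ 0 + C U²»` with
  `A₀ + E_N = a_Γ U² (1 + η')` the total channel drive.

The diagonal supersolution (the upper bound for the bottom of the LEADING block along a fixed form factor, which the gap
of DECOMP C2 (c) needs) is file V, `KLProgrammeCooperChannelRiccatiFlowDiagonal.lean`.

References: HOME/DECOMP.md v7 §2 C2, App. E (E2, Lemma E.4); M. Reed, B. Simon, *Methods of Modern Mathematical
Physics I*, Thm. VI.8 (numerical radius of a self-adjoint operator) — here taken from Mathlib.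
-/

noncomputable section

namespace Summit.HubbardSuperconductivity.HubbardSuperconductivity.Theorems.CooperChannelRiccatiFlow

set_option linter.dupNamespace false -- summit = problem name (single-conjunct summit), D-0017

open scoped InnerProductSpace ComplexConjugate
open RCLike ContinuousLinearMap Finset

variable {E : Type*} [NormedAddCommGroup E] [InnerProductSpace ℂ E]

/-! ## The norm of a symmetric operator is read off the two ends of its form -/

/-- `Re ⟪w, T w⟫ ≤ formSup T · ‖w‖²` for every vector `w` (homogeneous form of `re_inner_le_formSup`). -/
theorem re_inner_le_formSup_mul_norm_sq (T : E →L[ℂ] E) (w : E) :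
    re ⟪w, T w⟫_ℂ ≤ formSup T * ‖w‖ ^ 2 := by
  have h := formInf_mul_norm_sq_le (-T) w
  rw [show (-T) w = -(T w) from rfl, inner_neg_right, map_neg] at h
  rw [formSup]
  linarith

/-- The Rayleigh quotient of `T` is bounded by the larger end of the form: `|Re ⟪T x, x⟫ / ‖x‖²| ≤ max |formInf T| |formSup T|`. -/
theorem abs_rayleighQuotient_le_max (T : E →L[ℂ] E) (x : E) :
    |T.rayleighQuotient x| ≤ max |formInf T| |formSup T| := by
  have hmax : 0 ≤ max |formInf T| |formSup T| := le_max_of_le_left (abs_nonneg _)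
  by_cases hx : x = 0
  · simp only [hx, rayleighQuotient_apply_zero, abs_zero]
    exact hmax
  · have hx2 : 0 < ‖x‖ ^ 2 := by positivity
    have h1 := formInf_mul_norm_sq_le T x
    have h2 := re_inner_le_formSup_mul_norm_sq T x
    have hlo : -max |formInf T| |formSup T| ≤ formInf T :=
      (neg_le_neg (le_max_left _ _)).trans (neg_abs_le _)
    have hhi : formSup T ≤ max |formInf T| |formSup T| := (le_abs_self _).trans (le_max_right _ _)
    simp only [ContinuousLinearMap.rayleighQuotient, ContinuousLinearMap.reApplyInnerSelf_apply]
    rw [inner_re_symm, abs_le, le_div_iff₀ hx2, div_le_iff₀ hx2]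
    constructor <;> nlinarith

/-- **The norm of a symmetric operator is at most the larger end of its form** (numerical radius = norm). -/
theorem norm_le_max_abs_formInf_formSup {T : E →L[ℂ] E} (hT : (T : E →ₗ[ℂ] E).IsSymmetric) :
    ‖T‖ ≤ max |formInf T| |formSup T| := by
  rw [T.norm_eq_iSup_rayleighQuotient hT]
  exact ciSup_le fun x => abs_rayleighQuotient_le_max T x

/-- **`‖T‖ = max (|formInf T|, |formSup T|)` for a symmetric bounded operator** on a complex inner-product space. -/
theorem norm_eq_max_abs_formInf_formSup {T : E →L[ℂ] E} (hT : (T : E →ₗ[ℂ] E).IsSymmetric) :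
    ‖T‖ = max |formInf T| |formSup T| :=
  le_antisymm (norm_le_max_abs_formInf_formSup hT) (max_le (abs_formInf_le_norm T) (abs_formSup_le_norm T))

/-- **Two-sided form envelopes are a norm bound:** `-M ≤ formInf T`, `formSup T ≤ M` ⇒ `‖T‖ ≤ M` (symmetric `T`). -/
theorem norm_le_of_forms_le {T : E →L[ℂ] E} (hT : (T : E →ₗ[ℂ] E).IsSymmetric) {M : ℝ}
    (h₁ : -M ≤ formInf T) (h₂ : formSup T ≤ M) : ‖T‖ ≤ M := by
  refine (norm_le_max_abs_formInf_formSup hT).trans (max_le ?_ ?_)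
  · rcases subsingleton_or_nontrivial E with hE | hE
    · rw [formInf_of_subsingleton] at h₁ ⊢
      rw [abs_zero]
      linarith
    · exact abs_le.mpr ⟨h₁, (formInf_le_formSup T).trans h₂⟩
  · rcases subsingleton_or_nontrivial E with hE | hE
    · have h0 : formSup T = 0 := by rw [formSup, formInf_of_subsingleton, neg_zero]
      rw [formInf_of_subsingleton] at h₁
      rw [h0, abs_zero]
      linarith
    · exact abs_le.mpr ⟨h₁.trans (formInf_le_formSup T), h₂⟩

/-! ## Two-sided inverses of `1 + X`: a norm bound -/

/-- If `(1 + X) R = 1` and `‖X‖ ≤ c < 1` then `‖R‖ ≤ 1 / (1 - c)` (no completeness needed: `R` is given). -/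
theorem norm_inverse_le {X R : E →L[ℂ] E} {c : ℝ} (hX : ‖X‖ ≤ c) (hc : c < 1) (hR : (1 + X) * R = 1) :
    ‖R‖ ≤ 1 / (1 - c) := by
  have h1c : 0 < 1 - c := by linarith
  refine ContinuousLinearMap.opNorm_le_bound _ (by positivity) fun v => ?_
  have hv : R v + X (R v) = v := by
    have h := congrArg (fun S : E →L[ℂ] E => S v) hR
    exact h
  have h3 : ‖R v‖ ≤ ‖R v + X (R v)‖ + ‖X (R v)‖ := by
    simpa using norm_sub_le (R v + X (R v)) (X (R v))
  have h4 : ‖X (R v)‖ ≤ c * ‖R v‖ := (X.le_opNorm _).trans (by gcongr)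
  rw [hv] at h3
  rw [one_div, ← div_eq_inv_mul, le_div_iff₀ h1c]
  nlinarith

/-- The inverse of `1 + b V` with `|b| ‖V‖ ≤ 1/4` has norm `≤ 4/3`. -/
theorem norm_inverse_le_four_thirds {V R : E →L[ℂ] E} {b : ℝ} (hb : |b| * ‖V‖ ≤ 1 / 4)
    (hR : (1 + b • V) * R = 1) : ‖R‖ ≤ 4 / 3 := by
  have hX : ‖b • V‖ ≤ 1 / 4 := by rwa [norm_smul, Real.norm_eq_abs]
  have h := norm_inverse_le hX (by norm_num) hR
  norm_num at h
  exact h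

/-! ## One step of a block flow `V' = V R + P`, `R = (1 + b V)⁻¹`, `‖P‖ ≤ e` -/

/-- **One step, bottom of the form:** `|formInf V' - cascadeStep b (formInf V)| ≤ e` whenever `‖V' - V R‖ ≤ e`
(symmetric `V`, `|b| ‖V‖ ≤ 1/4`, `R` a two-sided inverse of `1 + b V`). -/
theorem abs_formInf_sub_cascadeStep_le {V V' R : E →L[ℂ] E} {b e : ℝ} (hV : (V : E →ₗ[ℂ] E).IsSymmetric)
    (hb : |b| * ‖V‖ ≤ 1 / 4) (hR₁ : (1 + b • V) * R = 1) (hR₂ : R * (1 + b • V) = 1)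
    (hP : ‖V' - V * R‖ ≤ e) : |formInf V' - cascadeStep b (formInf V)| ≤ e := by
  have h := abs_formInf_cascade_add_sub_le hV hb hR₁ hR₂ (V' - V * R)
  rw [add_sub_cancel] at h
  exact h.trans hP

/-- **One step, top of the form:** `|formSup V' - cascadeStep b (formSup V)| ≤ e` whenever `‖V' - V R‖ ≤ e`. -/
theorem abs_formSup_sub_cascadeStep_le {V V' R : E →L[ℂ] E} {b e : ℝ} (hV : (V : E →ₗ[ℂ] E).IsSymmetric)
    (hb : |b| * ‖V‖ ≤ 1 / 4) (hR₁ : (1 + b • V) * R = 1) (hR₂ : R * (1 + b • V) = 1)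
    (hP : ‖V' - V * R‖ ≤ e) : |formSup V' - cascadeStep b (formSup V)| ≤ e := by
  have h := abs_formSup_add_sub_le (V * R) (V' - V * R)
  rw [add_sub_cancel, formSup_cascade hV hb hR₁ hR₂] at h
  exact h.trans hP

/-- Before the onset, automatically: `0 < 1 + b · formInf V` and `0 < 1 + b · formSup V` when `|b| ‖V‖ ≤ 1/4`. -/
theorem onset_free_of_small {V : E →L[ℂ] E} {b : ℝ} (hb : |b| * ‖V‖ ≤ 1 / 4) :
    0 < 1 + b * formInf V ∧ 0 < 1 + b * formSup V := by
  have h1 := abs_le.mp (abs_mul_le_quarter (abs_formInf_le_norm V) hb)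
  have h2 := abs_le.mp (abs_mul_le_quarter (abs_formSup_le_norm V) hb)
  constructor <;> linarith

/-! ## Scalar one-step envelope lemmas (the induction steps of file III, isolated) -/

/-- **Attractive envelope, one step:** from `attractiveEnvelope A B ≤ x` and `x' ≥ cascadeStep b x - d` (no onset:
`(A + d)(B + b) < 1`) to `attractiveEnvelope (A + d) (B + b) ≤ x'`. -/
theorem attractiveEnvelope_step {A d B b x x' : ℝ} (hA : 0 ≤ A) (hd : 0 ≤ d) (hB : 0 ≤ B) (hb : 0 ≤ b)
    (honset : (A + d) * (B + b) < 1) (hx : attractiveEnvelope A B ≤ x) (hx' : cascadeStep b x - d ≤ x') :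
    attractiveEnvelope (A + d) (B + b) ≤ x' := by
  have hAB' : A * (B + b) < 1 :=
    lt_of_le_of_lt (by nlinarith [mul_nonneg hd (add_nonneg hB hb)]) honset
  have hAB : A * B < 1 := by nlinarith [mul_nonneg hA hb]
  have h1 : 0 < 1 - A * B := by linarith
  have h2 : 0 < 1 - A * (B + b) := by linarith
  have hℓpos : 0 < 1 + b * attractiveEnvelope A B := by
    rw [one_add_mul_attractiveEnvelope h1.ne']
    exact div_pos h2 h1
  have hxpos : 0 < 1 + b * x := by nlinarith [mul_le_mul_of_nonneg_left hx hb]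
  calc attractiveEnvelope (A + d) (B + b) ≤ attractiveEnvelope A (B + b) - d :=
        attractiveEnvelope_add_le hA hd (add_nonneg hB hb) honset
    _ = cascadeStep b (attractiveEnvelope A B) - d := by rw [cascadeStep_attractiveEnvelope h1.ne' h2.ne']
    _ ≤ cascadeStep b x - d := by
        gcongr ?_ - _
        exact cascadeStep_mono hx hℓpos hxpos
    _ ≤ x' := hx'

/-- **Repulsive envelope, one step:** from `x ≤ repulsiveEnvelope A B + Es`, `x' ≤ cascadeStep b x + e` (before the onset)
to `x' ≤ repulsiveEnvelope A (B + b) + (Es + e)`. -/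
theorem repulsiveEnvelope_step {A B b Es e x x' : ℝ} (hA : 0 ≤ A) (hB : 0 ≤ B) (hb : 0 ≤ b) (hEs : 0 ≤ Es)
    (hx : x ≤ repulsiveEnvelope A B + Es) (hxpos : 0 < 1 + b * x) (hx' : x' ≤ cascadeStep b x + e) :
    x' ≤ repulsiveEnvelope A (B + b) + (Es + e) := by
  have hψ := repulsiveEnvelope_nonneg hA hB
  have hμpos : 0 < 1 + b * (repulsiveEnvelope A B + Es) := by
    nlinarith [mul_nonneg hb (add_nonneg hψ hEs)]
  have h1 : (1 : ℝ) + A * B ≠ 0 := by nlinarith [mul_nonneg hA hB]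
  have h2 : (1 : ℝ) + A * (B + b) ≠ 0 := by nlinarith [mul_nonneg hA (add_nonneg hB hb)]
  calc x' ≤ cascadeStep b x + e := hx'
    _ ≤ cascadeStep b (repulsiveEnvelope A B + Es) + e := by
        gcongr ?_ + _
        exact cascadeStep_mono hx hxpos hμpos
    _ ≤ (cascadeStep b (repulsiveEnvelope A B) + Es) + e := by
        gcongr ?_ + _
        exact cascadeStep_add_le hb hψ hEs
    _ = repulsiveEnvelope A (B + b) + (Es + e) := by
        rw [cascadeStep_repulsiveEnvelope h1 h2]
        ring

/-- **Trivial envelope, one step:** `x' ≤ cascadeStep b x + e ≤ x + e` for `b ≥ 0` before the onset. -/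
theorem step_le_add {b e x x' : ℝ} (hb : 0 ≤ b) (hxpos : 0 < 1 + b * x) (hx' : x' ≤ cascadeStep b x + e) :
    x' ≤ x + e := by
  linarith [cascadeStep_le_self hb hxpos]

/-! ## The assembled block flow (DECOMP App. E, Lemma E.4's citation of C2) -/

section BlockFlow

variable {V R : ℕ → E →L[ℂ] E} {b e : ℕ → ℝ} {A₀ A M : ℝ} {N : ℕ}

/-- Monotonicity bookkeeping: with `E_k = Σ_{j<k} e_j`, `B_k = Σ_{j<k} b_j` (`e, b ≥ 0`) and no onset at `N`, the attractive
envelope at `k ≤ N` dominates the one at `N`: `attractiveEnvelope (A₀ + E_N) B_N ≤ attractiveEnvelope (A₀ + E_k) B_k`. -/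
theorem attractiveEnvelope_total_le (hb : ∀ k, 0 ≤ b k) (he : ∀ k, 0 ≤ e k) (hA₀ : 0 ≤ A₀)
    (honset : (A₀ + ∑ j ∈ range N, e j) * (∑ j ∈ range N, b j) < 1) {k : ℕ} (hk : k ≤ N) :
    attractiveEnvelope (A₀ + ∑ j ∈ range N, e j) (∑ j ∈ range N, b j) ≤
      attractiveEnvelope (A₀ + ∑ j ∈ range k, e j) (∑ j ∈ range k, b j) := by
  have hEk : ∑ j ∈ range k, e j ≤ ∑ j ∈ range N, e j :=
    sum_le_sum_of_subset_of_nonneg (range_mono hk) fun j _ _ => he j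
  have hBk : ∑ j ∈ range k, b j ≤ ∑ j ∈ range N, b j :=
    sum_le_sum_of_subset_of_nonneg (range_mono hk) fun j _ _ => hb j
  have hEk0 : 0 ≤ ∑ j ∈ range k, e j := sum_nonneg fun j _ => he j
  have hBN0 : 0 ≤ ∑ j ∈ range N, b j := sum_nonneg fun j _ => hb j
  have hAk0 : 0 ≤ A₀ + ∑ j ∈ range k, e j := add_nonneg hA₀ hEk0
  set d : ℝ := ∑ j ∈ range N, e j - ∑ j ∈ range k, e j with hd_def
  have hd : 0 ≤ d := by rw [hd_def]; linarith
  have hsplit : A₀ + ∑ j ∈ range N, e j = (A₀ + ∑ j ∈ range k, e j) + d := by rw [hd_def]; ring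
  have honset' : ((A₀ + ∑ j ∈ range k, e j) + d) * (∑ j ∈ range N, b j) < 1 := by rwa [← hsplit]
  have hkN : (A₀ + ∑ j ∈ range k, e j) * (∑ j ∈ range N, b j) < 1 :=
    lt_of_le_of_lt (by nlinarith) honset'
  calc attractiveEnvelope (A₀ + ∑ j ∈ range N, e j) (∑ j ∈ range N, b j)
      = attractiveEnvelope ((A₀ + ∑ j ∈ range k, e j) + d) (∑ j ∈ range N, b j) := by rw [hsplit]
    _ ≤ attractiveEnvelope (A₀ + ∑ j ∈ range k, e j) (∑ j ∈ range N, b j) - d :=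
        attractiveEnvelope_add_le hAk0 hd hBN0 honset'
    _ ≤ attractiveEnvelope (A₀ + ∑ j ∈ range k, e j) (∑ j ∈ range N, b j) := by linarith
    _ ≤ attractiveEnvelope (A₀ + ∑ j ∈ range k, e j) (∑ j ∈ range k, b j) :=
        attractiveEnvelope_anti_right hAk0 hBk hkN

/-- From the three envelopes at `k ≤ N` to the norm budget `‖V_k‖ ≤ M` (symmetric `V_k`). -/
theorem norm_le_of_envelopes {k : ℕ} (hV : (V k : E →ₗ[ℂ] E).IsSymmetric) (hb : ∀ k, 0 ≤ b k)
    (he : ∀ k, 0 ≤ e k) (hA₀ : 0 ≤ A₀) (hA : 0 ≤ A)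
    (honset : (A₀ + ∑ j ∈ range N, e j) * (∑ j ∈ range N, b j) < 1)
    (hMinf : -M ≤ attractiveEnvelope (A₀ + ∑ j ∈ range N, e j) (∑ j ∈ range N, b j))
    (hMsup : A + ∑ j ∈ range N, e j ≤ M) (hk : k ≤ N)
    (hinf : attractiveEnvelope (A₀ + ∑ j ∈ range k, e j) (∑ j ∈ range k, b j) ≤ formInf (V k))
    (hsup : formSup (V k) ≤ repulsiveEnvelope A (∑ j ∈ range k, b j) + ∑ j ∈ range k, e j) :
    ‖V k‖ ≤ M := by
  have hEk : ∑ j ∈ range k, e j ≤ ∑ j ∈ range N, e j :=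
    sum_le_sum_of_subset_of_nonneg (range_mono hk) fun j _ _ => he j
  have hBk0 : 0 ≤ ∑ j ∈ range k, b j := sum_nonneg fun j _ => hb j
  have hrep : repulsiveEnvelope A (∑ j ∈ range k, b j) ≤ A := by
    rw [repulsiveEnvelope]
    exact div_le_self hA (by nlinarith [mul_nonneg hA hBk0])
  refine norm_le_of_forms_le hV ?_ ?_
  · exact hMinf.trans ((attractiveEnvelope_total_le hb he hA₀ honset hk).trans hinf)
  · linarith

/-- **The assembled block flow (DECOMP C2, as cited by App. E Lemma E.4).**  Let `V_k` (`k ≤ N`) be symmetric bounded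
operators on a complex inner-product space (the `D₄` blocks of the Cooper vertex, `k = 0` the ultraviolet end), `b_k ≥ 0`
the single-scale bubble masses, `e_k ≥ 0` the remainder sizes, `M` a norm budget with `b_k M ≤ 1/4`, and suppose
* initial data: `-A₀ ≤ formInf V₀`, `formSup V₀ ≤ A` (`A₀, A ≥ 0`);
* no onset up to `N` even with all the drive injected at once: `(A₀ + E_N) B_N < 1`, and the budget holds the envelopes:
  `-M ≤ attractiveEnvelope (A₀ + E_N) B_N`, `A + E_N ≤ M` (`E_k = Σ_{j<k} e_j`, `B_k = Σ_{j<k} b_j`);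
* the flow, in the form a joint induction supplies (each step MAY ASSUME `‖V_k‖ ≤ M`): `R_k` is a two-sided inverse of
  `1 + b_k V_k` and `‖V_{k+1} - V_k R_k‖ ≤ e_k`.
Then for every `k ≤ N`: `attractiveEnvelope (A₀ + E_k) B_k ≤ formInf V_k ≤ formInf V₀ + E_k`,
`formSup V_k ≤ repulsiveEnvelope A B_k + E_k`, and `‖V_k‖ ≤ M`. -/
theorem blockFlow_envelopes (hV : ∀ k, (V k : E →ₗ[ℂ] E).IsSymmetric) (hb : ∀ k, 0 ≤ b k) (he : ∀ k, 0 ≤ e k)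
    (hbM : ∀ k < N, b k * M ≤ 1 / 4)
    (hA₀ : 0 ≤ A₀) (h0inf : -A₀ ≤ formInf (V 0)) (hA : 0 ≤ A) (h0sup : formSup (V 0) ≤ A)
    (honset : (A₀ + ∑ j ∈ range N, e j) * (∑ j ∈ range N, b j) < 1)
    (hMinf : -M ≤ attractiveEnvelope (A₀ + ∑ j ∈ range N, e j) (∑ j ∈ range N, b j))
    (hMsup : A + ∑ j ∈ range N, e j ≤ M)
    (hR : ∀ k < N, ‖V k‖ ≤ M → (1 + b k • V k) * R k = 1 ∧ R k * (1 + b k • V k) = 1)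
    (hstep : ∀ k < N, ‖V k‖ ≤ M → ‖V (k + 1) - V k * R k‖ ≤ e k) :
    ∀ k ≤ N,
      attractiveEnvelope (A₀ + ∑ j ∈ range k, e j) (∑ j ∈ range k, b j) ≤ formInf (V k) ∧
      formInf (V k) ≤ formInf (V 0) + ∑ j ∈ range k, e j ∧
      formSup (V k) ≤ repulsiveEnvelope A (∑ j ∈ range k, b j) + ∑ j ∈ range k, e j ∧
      ‖V k‖ ≤ M := by
  -- the three envelopes, by induction; the norm budget follows from them at every stage
  have henv : ∀ k ≤ N,
      attractiveEnvelope (A₀ + ∑ j ∈ range k, e j) (∑ j ∈ range k, b j) ≤ formInf (V k) ∧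
      formInf (V k) ≤ formInf (V 0) + ∑ j ∈ range k, e j ∧
      formSup (V k) ≤ repulsiveEnvelope A (∑ j ∈ range k, b j) + ∑ j ∈ range k, e j := by
    intro k
    induction k with
    | zero =>
      intro _
      refine ⟨?_, ?_, ?_⟩
      · simpa [attractiveEnvelope] using h0inf
      · simp
      · simpa [repulsiveEnvelope] using h0sup
    | succ k ih =>
      intro hk
      have hk' : k < N := Nat.lt_of_succ_le hk
      obtain ⟨hinf, htriv, hsup⟩ := ih hk'.le
      have hnorm : ‖V k‖ ≤ M := norm_le_of_envelopes (hV k) hb he hA₀ hA honset hMinf hMsup hk'.le hinf hsup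
      have hsmall : |b k| * ‖V k‖ ≤ 1 / 4 := by
        rw [abs_of_nonneg (hb k)]
        exact (mul_le_mul_of_nonneg_left hnorm (hb k)).trans (hbM k hk')
      obtain ⟨hR₁, hR₂⟩ := hR k hk' hnorm
      have hP := hstep k hk' hnorm
      have h1 := abs_le.mp (abs_formInf_sub_cascadeStep_le (hV k) hsmall hR₁ hR₂ hP)
      have h2 := abs_le.mp (abs_formSup_sub_cascadeStep_le (hV k) hsmall hR₁ hR₂ hP)
      obtain ⟨hposinf, hpossup⟩ := onset_free_of_small hsmall
      have hEk0 : 0 ≤ ∑ j ∈ range k, e j := sum_nonneg fun j _ => he j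
      have hBk0 : 0 ≤ ∑ j ∈ range k, b j := sum_nonneg fun j _ => hb j
      -- no onset at stage k + 1
      have hEk1 : ∑ j ∈ range (k + 1), e j ≤ ∑ j ∈ range N, e j :=
        sum_le_sum_of_subset_of_nonneg (range_mono hk) fun j _ _ => he j
      have hBk1 : ∑ j ∈ range (k + 1), b j ≤ ∑ j ∈ range N, b j :=
        sum_le_sum_of_subset_of_nonneg (range_mono hk) fun j _ _ => hb j
      have honset1 : (A₀ + ∑ j ∈ range k, e j + e k) * (∑ j ∈ range k, b j + b k) < 1 := by
        have h : (A₀ + ∑ j ∈ range (k + 1), e j) * (∑ j ∈ range (k + 1), b j) < 1 := by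
          refine lt_of_le_of_lt ?_ honset
          exact mul_le_mul (by linarith) hBk1 (sum_nonneg fun j _ => hb j)
            (add_nonneg hA₀ (sum_nonneg fun j _ => he j))
        rw [sum_range_succ, sum_range_succ, ← add_assoc] at h
        exact h
      refine ⟨?_, ?_, ?_⟩
      · rw [sum_range_succ, sum_range_succ, ← add_assoc]
        exact attractiveEnvelope_step (add_nonneg hA₀ hEk0) (he k) hBk0 (hb k) honset1 hinf (by linarith)
      · rw [sum_range_succ, ← add_assoc]
        linarith [step_le_add (hb k) hposinf (show formInf (V (k + 1)) ≤ cascadeStep (b k) (formInf (V k)) + e k by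
          linarith)]
      · rw [sum_range_succ, sum_range_succ]
        exact repulsiveEnvelope_step hA hBk0 (hb k) hEk0 hsup hpossup (by linarith)
  intro k hk
  obtain ⟨hinf, htriv, hsup⟩ := henv k hk
  exact ⟨hinf, htriv, hsup, norm_le_of_envelopes (hV k) hb he hA₀ hA honset hMinf hMsup hk hinf hsup⟩

end BlockFlow

end Summit.HubbardSuperconductivity.HubbardSuperconductivity.Theorems.CooperChannelRiccatiFlow

end
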